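import Summits.CriticalPhenomena.CardyFormulaZ2.Theorems.CardySusyWardParafermionFamiliesToSLESixWiredOrbitEmpty

/-!
# The concrete anchor family (skeleton r4 of line `strip-anchored-vertex-normalisation`,
# crux stmt-CriticalPhenomena-10814), VIII: the ABSOLUTE phases of the upper-left WIRED swing corners

Registered sub-goal `stub_anchorWiredPhaseUL` of the stub `stub_anchorMoment_of_IP`; the mirror image of
the lower-right package `…WiredPhaseLR.lean`. For the concrete anchor data `E = anchorData δ` at level `L`
(`L δ < 2 ≤ (L + 1) δ`; `s = v₀ + v₁`, `d = v₀ - v₁`; the sites with `d ∈ {-(L - 1), -L}` form the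
upper-left side of the wired arc `A`, `…AnchorDataLattice.lean`, `AnchorWired.memA_of`), every boundary face
`F` of that side (`d(F) = -(L - 1)`; corners `F`, `F + e₁`, `F + e₀ + e₁` on `A`, `F + e₀` inside) is swung
around CLOCKWISE by the exploration whenever it is visited: the entering dart `(F, 0)` (from the layer edge
`s(F, F + e₀)` to the frozen-open `A`–`A` edge `s(F, F + e₁)`), the dart `(F + e₁, 3)` between the two
frozen-open sides of `F`, and the leaving dart `(F + e₀ + e₁, 2)` (back to the layer edge
`s(F + e₀ + e₁, F + e₀)`) come together, with turn counts `t, t - 1, t - 2` (`swing_fwd`, `swing_bwd`).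

* `orbit_left`, `shift_UL`, `visit_all` — ABSOLUTE anchoring in the completed ALL-CLOSED configuration
  `E.bcBondConfig ∅`, continuing `…WiredOrbitEmpty.lean` (lower-right side, bottom vertex, lower-left side
  up to `AnchorWiredEmpty.orbit_LL_end` = the dart `((-(L-1),-1), 0)` with turn count `-2`): two explicit
  steps around the left vertex (follow `s((-(L-1),-1),(-(L-1),0))`, cross `s((-(L-1),0),(-(L-2),0))`) reach
  the entering dart `((-(L-1),0), 0)` of the first upper-left face with turn count `-2`, and the exploration
  then moves one face up the side every four steps (follow, follow, cross, cross: same turn count), so it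
  visits every `(F, 0)` of the side (`-(L - 1) ≤ s(F) ≤ L - 3`) with turn count `-2`;
* the wired TouchPhase `WiredTouch.turnCount_visit_const` (`…WiredTouch.lean`) transfers `-2` to every
  visit of `(F, 0)` in every configuration, hence `-4` to every visit of the leaving dart (`swing_fwd/bwd`),
  and `WiredTouch.cornerObs_eq_of_visit_iff` evaluates both corners on the common event
  `{(F, 0) is visited}`: `G(F, F) = sixthPhase (-2) · P`, `G(F + e₀ + e₁, F) = sixthPhase (-4) · P`.
-/

noncomputable section

namespace Summit.CriticalPhenomena.CardyFormulaZ2.Theorems.ParafermionFamiliesToSLESix.StripAnchored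

open MeasureTheory Filter Set Metric
open scoped Topology BigOperators
open Literature.Probability.LatticeModels
open Literature.Probability.Percolation (bondPercolation half BondConfig)
open Literature.Probability.RandomPlanarGeometry (DobrushinDomain)
open Summit.CriticalPhenomena.CardyFormulaZ2.Theorems.ParafermionPrecompact.Negative (IsFamily VanishesOn)
open Summit.CriticalPhenomena.CardyFormulaZ2.Cruxes.EdgePrecompact.QkzStripBoundaryArm (cornerObs)
open Literature.Probability.LatticeModels.DiscreteDobrushin (startCorner exitTime isStartCorner_startCorner
  isInnerFace_of_lt_exitTime not_isInnerFace_exitTime)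
open S5 (anchorDomain)
open S2 (sixthPhase)

namespace AnchorWiredUL

variable {δ : ℝ} {L : ℤ}

section Level

variable (hδ : 0 < δ) (hLδ : (L : ℝ) * δ < 2) (hL1 : 2 ≤ ((L : ℝ) + 1) * δ) (hL : 4 ≤ L)
  (hE : (anchorData δ).IsZdAdmissible)
include hδ hLδ hL1 hL

/-! ### The swing around a boundary face, in every configuration -/

/-- **The swing, forward.** If the exploration is at the entering dart `(F, 0)` of a face `F` of the
upper-left wired side (`d(F) = -(L - 1)`, `-L ≤ s(F) ≤ L - 2`) at time `n < T`, it follows the two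
frozen-open sides `s(F, F + e₁)`, `s(F + e₁, F + e₀ + e₁)` of `F`: `orb (n + 1) = (F + e₁, 3)`,
`orb (n + 2) = (F + e₀ + e₁, 2)`, `n + 2 < T`, turn counts `t - 1`, `t - 2`. [cite: Smirnov2001, §2] -/
theorem swing_fwd {F : Site 2} (hd : F 0 - F 1 = -(L - 1)) (hs : F 0 + F 1 ≤ L - 2) (hs' : -L ≤ F 0 + F 1)
    {ω : BondConfig (Site 2)} {n : ℕ} (hn : n < exitTime hE ω)
    (h : cornerOrbit ((anchorData δ).bcBondConfig ω) (startCorner hE) n = (F, 0)) :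
    n + 2 < exitTime hE ω ∧
      cornerOrbit ((anchorData δ).bcBondConfig ω) (startCorner hE) (n + 1) = (F + cornerUnit 1, 3) ∧
      cornerOrbit ((anchorData δ).bcBondConfig ω) (startCorner hE) (n + 2) = (F + cornerUnit 0 + cornerUnit 1, 2) ∧
      turnCount ((anchorData δ).bcBondConfig ω) (startCorner hE) (n + 1) =
        turnCount ((anchorData δ).bcBondConfig ω) (startCorner hE) n - 1 ∧
      turnCount ((anchorData δ).bcBondConfig ω) (startCorner hE) (n + 2) =
        turnCount ((anchorData δ).bcBondConfig ω) (startCorner hE) n - 2 := by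
  -- follow `s(F, F + e₁)`
  obtain ⟨hT1, h1, htc1⟩ := AnchorFree.step_open hE (v' := F + cornerUnit 1) (k' := 3) hn h
    (AnchorWired.openA_tgt hδ hLδ hL1 hL _ (by omega) (by simp; omega))
    (by ext i; fin_cases i <;> simp) rfl (AnchorFree.face_of hδ hLδ hL1 (by simp [cFace, faceAt]; omega))
  -- follow `s(F + e₁, F + e₀ + e₁)`
  obtain ⟨hT2, h2, htc2⟩ := AnchorFree.step_open hE (v' := F + cornerUnit 0 + cornerUnit 1) (k' := 2) hT1 h1
    (AnchorWired.openA_tgt hδ hLδ hL1 hL _ (by simp; omega) (by simp; omega))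
    (by ext i; fin_cases i <;> simp) rfl (AnchorFree.face_of hδ hLδ hL1 (by simp [cFace, faceAt]; omega))
  exact ⟨hT2, h1, h2, htc1, by rw [htc2, htc1]; ring⟩

/-- **The swing, backward.** A visit `orb n = (F + e₀ + e₁, 2)` of the leaving dart of such a face is
preceded by the two other darts of the swing: `n = n' + 2`, `orb n' = (F, 0)`, `orb (n' + 1) = (F + e₁, 3)`
(the source edges `s(F + e₀ + e₁, F + e₁)`, `s(F + e₁, F)` are frozen open, so the predecessors are the
follow-predecessors, `WiredTouch.orbit_pred_of_mem`; neither dart is the start corner `((L-1,1), 2)`: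
`d(F + e₀ + e₁) = -(L - 1) ≠ L - 2`). [cite: Smirnov2001, §2] -/
theorem swing_bwd {F : Site 2} (hd : F 0 - F 1 = -(L - 1)) (hs : F 0 + F 1 ≤ L - 2) (hs' : -L ≤ F 0 + F 1)
    {ω : BondConfig (Site 2)} {n : ℕ}
    (h : cornerOrbit ((anchorData δ).bcBondConfig ω) (startCorner hE) n = (F + cornerUnit 0 + cornerUnit 1, 2)) :
    ∃ n', n = n' + 2 ∧
      cornerOrbit ((anchorData δ).bcBondConfig ω) (startCorner hE) n' = (F, 0) ∧
      cornerOrbit ((anchorData δ).bcBondConfig ω) (startCorner hE) (n' + 1) = (F + cornerUnit 1, 3) := by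
  have hst := AnchorFree.startCorner_eq hδ hLδ hL1 hL hE
  have hne : (F + cornerUnit 0 + cornerUnit 1, (2 : Fin 4)) ≠ startCorner hE := by
    rw [hst, Ne, Prod.mk.injEq, not_and_or]
    refine Or.inl fun hF => ?_
    have h0 := congrFun hF 0
    have h1 := congrFun hF 1
    simp at h0 h1
    omega
  obtain ⟨j, rfl, hj⟩ := WiredTouch.orbit_pred_of_mem hE (v := F + cornerUnit 0 + cornerUnit 1) (k := 2) hne
    (AnchorWired.openA_of hδ hLδ hL1 hL (zdGraph_adj_add_cornerUnit _ 2) ω (by simp; omega) (by simp; omega)) h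
  have hj1 : cornerOrbit ((anchorData δ).bcBondConfig ω) (startCorner hE) j = (F + cornerUnit 1, 3) :=
    hj.trans (Prod.ext (by ext i; fin_cases i <;> simp) rfl)
  obtain ⟨j', rfl, hj'⟩ := WiredTouch.orbit_pred_of_mem hE (v := F + cornerUnit 1) (k := 3) (by rw [hst]; simp)
    (AnchorWired.openA_of hδ hLδ hL1 hL (zdGraph_adj_add_cornerUnit _ 3) ω (by simp; omega) (by simp; omega)) hj1
  have hj0 : cornerOrbit ((anchorData δ).bcBondConfig ω) (startCorner hE) j' = (F, 0) :=
    hj'.trans (Prod.ext (by ext i; fin_cases i <;> simp) rfl)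
  exact ⟨j', rfl, hj0, hj1⟩

/-! ### Absolute anchoring: the all-closed exploration along the upper-left side -/

/-- **Around the left vertex, in the all-closed exploration**: from the leaving dart `((-(L-1),-1), 0)` of
the last lower-left face (`AnchorWiredEmpty.orbit_LL_end`, turn count `-2`) follow the frozen-open
`s((-(L-1),-1),(-(L-1),0))` and cross the layer edge `s((-(L-1),0),(-(L-2),0))` (turns `-1, +1`): the entering
dart `((-(L-1),0), 0)` of the first upper-left face `(-(L-1),0)` (`d = -(L - 1)`, `s = -(L - 1)`) is visited
with turn count `-2`. [cite: Smirnov2001, §2] -/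
theorem orbit_left : ∃ n < exitTime hE ∅,
    cornerOrbit ((anchorData δ).bcBondConfig ∅) (startCorner hE) n = ((![-(L - 1), 0] : Site 2), 0) ∧
      turnCount ((anchorData δ).bcBondConfig ∅) (startCorner hE) n = -2 := by
  obtain ⟨n, hn, h, htc⟩ := AnchorWiredEmpty.orbit_LL_end hδ hLδ hL1 hL hE
  -- step 1: follow `s((-(L-1),-1),(-(L-1),0))`
  obtain ⟨hT1, h1, htc1⟩ := AnchorFree.step_open hE (v' := ![-(L - 1), 0]) (k' := 3) hn h
    (AnchorWired.openA_tgt hδ hLδ hL1 hL _ (by simp; omega) (by simp; omega))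
    (by ext i; fin_cases i <;> simp) rfl (AnchorFree.face_of hδ hLδ hL1 (by simp [cFace, faceAt]; omega))
  -- step 2: cross the layer edge `s((-(L-1),0),(-(L-2),0))`
  obtain ⟨hT2, h2, htc2⟩ := AnchorFree.step_closed hE (k' := 0) hT1 h1
    (AnchorWired.closed_empty_tgt hδ hLδ hL1 hL (by simp; omega)) rfl
    (AnchorFree.face_of hδ hLδ hL1 (by simp [cFace, faceAt]; omega))
  exact ⟨n + 1 + 1, hT2, h2, by rw [htc2, htc1, htc]; norm_num⟩

/-- **One face up the upper-left side, in the all-closed exploration.** From a visit `orb n = (F, 0)`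
(`n < T`, `d(F) = -(L - 1)`, `-(L - 1) ≤ s(F) ≤ L - 5`) four steps lead to `(F + e₀ + e₁, 0)` with the same
turn count: the swing (follow `s(F, F + e₁)`, `s(F + e₁, F + e₀ + e₁)`), then cross the layer edges
`s(F + e₀ + e₁, F + e₀)`, `s(F + e₀ + e₁, F + 2e₀ + e₁)` (turns `-1, -1, +1, +1`). [cite: Smirnov2001, §2] -/
theorem shift_UL {F : Site 2} (hd : F 0 - F 1 = -(L - 1)) (hs : F 0 + F 1 ≤ L - 5) (hs' : -(L - 1) ≤ F 0 + F 1)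
    {n : ℕ} (hn : n < exitTime hE ∅) (h : cornerOrbit ((anchorData δ).bcBondConfig ∅) (startCorner hE) n = (F, 0)) :
    n + 4 < exitTime hE ∅ ∧
      cornerOrbit ((anchorData δ).bcBondConfig ∅) (startCorner hE) (n + 4) = (F + cornerUnit 0 + cornerUnit 1, 0) ∧
      turnCount ((anchorData δ).bcBondConfig ∅) (startCorner hE) (n + 4) =
        turnCount ((anchorData δ).bcBondConfig ∅) (startCorner hE) n := by
  -- steps 1, 2: the swing
  obtain ⟨hT2, -, h2, -, htc2⟩ := swing_fwd hδ hLδ hL1 hL hE hd (by omega) (by omega) hn h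
  -- step 3: cross the layer edge `s(F + e₀ + e₁, F + e₀)`
  obtain ⟨hT3, h3, htc3⟩ := AnchorFree.step_closed hE (k' := 3) hT2 h2
    (AnchorWired.closed_empty_tgt hδ hLδ hL1 hL (by simp; omega)) rfl
    (AnchorFree.face_of hδ hLδ hL1 (by simp [cFace, faceAt]; omega))
  -- step 4: cross the layer edge `s(F + e₀ + e₁, F + 2e₀ + e₁)`
  obtain ⟨hT4, h4, htc4⟩ := AnchorFree.step_closed hE (k' := 0) hT3 h3
    (AnchorWired.closed_empty_tgt hδ hLδ hL1 hL (by simp; omega)) rfl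
    (AnchorFree.face_of hδ hLδ hL1 (by simp [cFace, faceAt]; omega))
  refine ⟨hT4, h4, ?_⟩
  rw [htc4, htc3, htc2]; ring

/-- **Every entering dart `(F, 0)` of the upper-left wired side is visited by the all-closed exploration,
with turn count `-2`.** By induction on `m`, for the face `F` with `d(F) = -(L - 1)` and
`s(F) = 2m - (L - 1) ≤ L - 3`: for `m = 0` this is `orbit_left`; the step is `shift_UL` at the previous face
`F - e₀ - e₁`. [cite: Smirnov2010, proof of Lemma 4.5] -/
theorem visit_all (m : ℕ) : ∀ F : Site 2, F 0 - F 1 = -(L - 1) → F 0 + F 1 = 2 * m - (L - 1) → F 0 + F 1 ≤ L - 3 →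
    ∃ n < exitTime hE ∅, cornerOrbit ((anchorData δ).bcBondConfig ∅) (startCorner hE) n = (F, 0) ∧
      turnCount ((anchorData δ).bcBondConfig ∅) (startCorner hE) n = -2 := by
  induction m with
  | zero =>
    intro F hd hs _
    push_cast at hs
    obtain ⟨n, hn, horb, htc⟩ := orbit_left hδ hLδ hL1 hL hE
    obtain rfl : F = ![-(L - 1), 0] := Site.eq_iff_two.2 ⟨by simp; omega, by simp; omega⟩
    exact ⟨n, hn, horb, htc⟩
  | succ m ih =>
    intro F hd hs hs'
    push_cast at hs
    -- the previous face `F - e₀ - e₁` of the side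
    obtain ⟨n, hn, h, htc⟩ := ih (F - cornerUnit 0 - cornerUnit 1) (by simp; omega) (by simp; omega)
      (by simp; omega)
    obtain ⟨hn4, h4, htc4⟩ := shift_UL hδ hLδ hL1 hL hE (F := F - cornerUnit 0 - cornerUnit 1)
      (by simp; omega) (by simp; omega) (by simp; omega) hn h
    have hF : F - cornerUnit 0 - cornerUnit 1 + cornerUnit 0 + cornerUnit 1 = F := by abel
    rw [hF] at h4
    exact ⟨n + 4, hn4, h4, htc4.trans htc⟩

/-! ### The two corner observables at a face of the side -/

include hE in
/-- **The absolute wired phases of the upper-left side at level `L`.** For every face `F` with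
`d(F) = -(L - 1)`, `|s(F)| ≤ L - 5` of the anchor data: `G(F, F) = sixthPhase (-2) · P` and
`G(F + e₀ + e₁, F) = sixthPhase (-4) · P`, `P` the probability that the exploration visits the entering dart
`(F, 0)` (= swings around `F`). The all-closed visit of `(F, 0)` has turn count `-2` (`visit_all`); the wired
TouchPhase (`WiredTouch.turnCount_visit_const`, hole-free inner faces by `holeFree_innerFaces`) transfers
`-2` to every visit of `(F, 0)`, and the swing (`swing_fwd/bwd`) makes the leaving dart visited exactly when
`(F, 0)` is, two steps later, with turn count `-4`; `WiredTouch.cornerObs_eq_of_visit_iff` evaluates both.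
[cite: DuminilCopin2012Parafermion, Proposition 5] -/
theorem wiredPhaseUL_of_level {F : Site 2} (hd : F 0 - F 1 = -(L - 1)) (hs : |F 0 + F 1| ≤ L - 5) :
    cornerObs (anchorData δ) δ F F = sixthPhase (-2) *
        (((bondPercolation (zdGraph 2) half).real
          {ω : BondConfig (Site 2) | ∃ n < exitTime hE ω,
            cornerOrbit ((anchorData δ).bcBondConfig ω) (startCorner hE) n = (F, 0)} : ℝ) : ℂ) ∧
      cornerObs (anchorData δ) δ (F + cornerUnit 0 + cornerUnit 1) F = sixthPhase (-4) *
        (((bondPercolation (zdGraph 2) half).real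
          {ω : BondConfig (Site 2) | ∃ n < exitTime hE ω,
            cornerOrbit ((anchorData δ).bcBondConfig ω) (startCorner hE) n = (F, 0)} : ℝ) : ℂ) := by
  rw [abs_le] at hs
  have hH : HoleFree {f : Site 2 | (anchorData δ).IsInnerFace f} :=
    holeFree_innerFaces anchorDomain.toJordanDomain rfl hδ
  -- the all-closed visit of `(F, 0)`, with turn count `-2`
  obtain ⟨m, hm⟩ := Int.eq_ofNat_of_zero_le (show (0 : ℤ) ≤ F 0 + (L - 1) by omega)
  obtain ⟨n₀, hn₀, h₀, htc₀⟩ := visit_all hδ hLδ hL1 hL hE m F hd (by omega) (by omega)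
  have hA : F ∈ (anchorData δ).zdArcA := AnchorWired.memA_of hδ hLδ hL1 hL (by omega)
  -- wired TouchPhase: every visit of `(F, 0)` has turn count `-2`
  have hτ : ∀ (ω : BondConfig (Site 2)) (n : ℕ), n < exitTime hE ω →
      cornerOrbit ((anchorData δ).bcBondConfig ω) (startCorner hE) n = (F, 0) →
      turnCount ((anchorData δ).bcBondConfig ω) (startCorner hE) n = -2 :=
    WiredTouch.turnCount_visit_const hE hH (c := (F, 0)) hA hn₀ h₀ htc₀
  obtain ⟨e2, -, e0⟩ := S5.cFace_corner_site F
  -- the leaving dart is visited iff `(F, 0)` is, with turn count `-4`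
  have hiff : ∀ ω : BondConfig (Site 2),
      (∃ j < exitTime hE ω, cornerOrbit ((anchorData δ).bcBondConfig ω) (startCorner hE) j =
        (F + cornerUnit 0 + cornerUnit 1, 2)) ↔
      ∃ n < exitTime hE ω, cornerOrbit ((anchorData δ).bcBondConfig ω) (startCorner hE) n = (F, 0) := by
    intro ω
    constructor
    · rintro ⟨j, hj, hjr⟩
      obtain ⟨n', rfl, hn', -⟩ := swing_bwd hδ hLδ hL1 hL hE hd (by omega) (by omega) hjr
      exact ⟨n', by omega, hn'⟩
    · rintro ⟨n, hn, hnr⟩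
      obtain ⟨hn2, -, h2, -, -⟩ := swing_fwd hδ hLδ hL1 hL hE hd (by omega) (by omega) hn hnr
      exact ⟨n + 2, hn2, h2⟩
  have hτ' : ∀ (ω : BondConfig (Site 2)) (j : ℕ), j < exitTime hE ω →
      cornerOrbit ((anchorData δ).bcBondConfig ω) (startCorner hE) j = (F + cornerUnit 0 + cornerUnit 1, 2) →
      turnCount ((anchorData δ).bcBondConfig ω) (startCorner hE) j = -4 := by
    intro ω j hj hjr
    obtain ⟨n', rfl, hn', -⟩ := swing_bwd hδ hLδ hL1 hL hE hd (by omega) (by omega) hjr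
    obtain ⟨-, -, -, -, htc2⟩ := swing_fwd hδ hLδ hL1 hL hE hd (by omega) (by omega) (by omega) hn'
    have := hτ ω n' (by omega) hn'
    omega
  exact ⟨WiredTouch.cornerObs_eq_of_visit_iff hE (r := (F, 0)) rfl e0 F (-2) (fun _ => Iff.rfl) hτ,
    WiredTouch.cornerObs_eq_of_visit_iff hE (r := (F + cornerUnit 0 + cornerUnit 1, 2)) rfl e2 F (-4) hiff hτ'⟩

end Level

end AnchorWiredUL

/-- **Registered sub-goal `stub_anchorWiredPhaseUL`** (of the stub `stub_anchorMoment_of_IP`, line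
`strip-anchored-vertex-normalisation`, skeleton r4): for `0 < δ ≤ 1/8` there is a level `L`
(`L δ < 2 ≤ (L + 1) δ`) such that every face `F` of the upper-left wired side of the concrete anchor data
`anchorData δ` (`F₀ - F₁ = -(L - 1)`, `|F₀ + F₁| ≤ L - 5`) has the ABSOLUTE corner phases
`G(F, F) = sixthPhase (-2) · P`, `G(F + e₀ + e₁, F) = sixthPhase (-4) · P` with one `P ≥ 0` (the probability
that the exploration swings around `F`). [cite: DuminilCopin2012Parafermion, Proposition 5] -/
theorem stub_anchorWiredPhaseUL : ∀ δ : ℝ, 0 < δ → δ ≤ 1 / 8 → ∃ L : ℤ, (L : ℝ) * δ < 2 ∧ 2 ≤ ((L : ℝ) + 1) * δ ∧ ∀ F : Site 2, F 0 - F 1 = -(L - 1) → |F 0 + F 1| ≤ L - 5 → ∃ P : ℝ, 0 ≤ P ∧ cornerObs (anchorData δ) δ F F = sixthPhase (-2) * (P : ℂ) ∧ cornerObs (anchorData δ) δ (F + cornerUnit 0 + cornerUnit 1) F = sixthPhase (-4) * (P : ℂ) := by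
  intro δ hδ hδ8
  obtain ⟨L, hL7, hLδ, hL1⟩ := AnchorLattice.exists_level hδ (hδ8.trans (by norm_num))
  exact ⟨L, hLδ, hL1, fun F hd hs => ⟨_, measureReal_nonneg,
    AnchorWiredUL.wiredPhaseUL_of_level hδ hLδ hL1 (by omega) (AnchorLattice.isZdAdmissible hδ hLδ hL1 (by omega))
      hd hs⟩⟩

end Summit.CriticalPhenomena.CardyFormulaZ2.Theorems.ParafermionFamiliesToSLESix.StripAnchored

end
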